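import Mathlib
import Summits.Ventures.HodgeRepro2.T5DualPairSwap
import Summits.Ventures.HodgeRepro2.T5TrivialPartner
import Summits.Ventures.HodgeRepro2.T6N42Defs

/-!
# T6N42Datum — sub-step N4.2: THE DATUM TYPE of record (TARGET-T6 v0.4 §9.6 (1); owner t6-p5)

The M2 composition carrier `NAut` (lead, §9.2(b)) takes the owners' DATUM TYPES as fields; this
file is t6-p5's: `ZetaDatum` (GQT's doubling zeta integral data attached to a dual pair — the
carrier of the zeta-integral form «Z_v^*(½) ≢ 0» of (R2), §9.3 «`N42_main` over
`N42Defs.ZetaDatum`») and `FinitePlacesDatum` (the N4.2 datum over the finite places of `F⁺`: at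
the places split in `E` the type II datum `(GL₂(F_v), GL₃(F_v), ω_{2,3}, π₀,v)`, at the non-split
places the Witt tower datum on `V₀ = V′_v` with `π₀,v` and `β′_v`, and at every place the zeta data
for the pair `(U(W₁₂,v), U(V_v))` — `V_v = V₁ = V′_v ⊕ ℍ` at the non-split places). Definition lane:
data and `Prop`-valued definitions only — no display, no theorem. The INTERFACE Props
(`IrreducibleSmooth`, `TypeIISizes`, `FirstLift`) are the hypotheses `N42_main` takes besides its
displays (ruling l. 4414 (q4): each discharged in kernel or declared at the M2 declaration); the
two conclusions are `ThetaNonzeroEverywhere` ((R2) in representation-theoretic form, the print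
path) and `ZetaNonzeroEverywhere` ((R2) in zeta-integral form, through GQT Prop. 35(i) — class AC).
Non-vacuity witnesses: `T6N42Toy.lean`.

README §8(d): uses an L-value-free non-vanishing device: NO (TIER5 §N4.2, a pre-02:16Z line of
record, continued).
-/

namespace Summit.Ventures.HodgeRepro2.T6.N42Defs

/-- GQT §11 at a finite place: the doubling zeta integral data attached to a dual pair datum —
`R(V_v)` (the image of the Schwartz space in the degenerate principal series `I(s, χ_V)`), the
contragredient `π_v^∨`, and the NORMALISED zeta integral `Z_v^*(s)` as a trilinear form on
`R(V_v) × π_v^∨ × π_v` for each `s`. All data; nothing is constructed (the print's construction of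
`R(V)` and of `Z_v^*` is not carried). -/
structure ZetaDatum (S : DualPairDatum) where
  /-- `R(V_v)`. -/
  R : Type
  [instAddR : AddCommGroup R]
  [instModR : Module ℂ R]
  /-- The space of `π_v^∨`. -/
  Vdual : Type
  [instAddVdual : AddCommGroup Vdual]
  [instModVdual : Module ℂ Vdual]
  /-- `s ↦ Z_v^*(s)` on `R(V_v) ⊗ π_v^∨ ⊗ π_v`. -/
  Zstar : ℂ → (R →ₗ[ℂ] Vdual →ₗ[ℂ] S.Vπ →ₗ[ℂ] ℂ)

namespace ZetaDatum

variable {S : DualPairDatum} (Z : ZetaDatum S)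

/-- The additive group of `R(V_v)`. -/
instance instAddR' : AddCommGroup Z.R := Z.instAddR

/-- The `ℂ`-module structure of `R(V_v)`. -/
instance instModR' : Module ℂ Z.R := Z.instModR

/-- The additive group of `π_v^∨`. -/
instance instAddVdual' : AddCommGroup Z.Vdual := Z.instAddVdual

/-- The `ℂ`-module structure of `π_v^∨`. -/
instance instModVdual' : Module ℂ Z.Vdual := Z.instModVdual

/-- «`Z_v^*(s_{m,n})` is nonzero on `R(V_{r,v}) ⊗ π_v^∨ ⊗ π_v`» at `s_{m,n} = ½` (the datum of N4.2:
`m = 3`, `n = 2`, `s_{3,2} = ½`): the trilinear form `Z_v^*(½)` is not identically zero. -/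
def Nonzero : Prop :=
  Z.Zstar (1 / 2) ≠ 0

end ZetaDatum

end Summit.Ventures.HodgeRepro2.T6.N42Defs

namespace Summit.Ventures.HodgeRepro2.T6.N42Datum

open Summit.Ventures.HodgeRepro2
open Summit.Ventures.HodgeRepro2.T6.N42Defs
open Summit.Ventures.HodgeRepro2.T5DualPairSwap
open Summit.Ventures.HodgeRepro2.T5TrivialPartner

/-- The N4.2 datum over the finite places of `F⁺` (TIER5 §B standing data, §K.2): the places split
in `E` carry the type II datum `(GL₂(F_v), GL₃(F_v), ω_{2,3}, π₀,v)`; the non-split places carry the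
Witt tower datum on `V₀ = V′_v` with `π₀,v` and the character `β′_v` of `H(V₀) = U(V′_v)`; every
place carries GQT's zeta data for the pair `(U(W₁₂,v), U(V_v))` — at a non-split place this is
the pair at level `1` of the tower, `V₁ = V′_v ⊕ ℍ ≅ V_v` (row B4's printed classification — the
identification is the instantiation's). -/
structure FinitePlacesDatum where
  /-- The finite places of `F⁺` split in `E`. -/
  SplitPlace : Type
  /-- The finite places of `F⁺` not split in `E` (`E_v` a field). -/
  NonsplitPlace : Type
  /-- The type II datum at a split place. -/
  splitDatum : SplitPlace → TypeIIDatum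
  /-- The Witt tower datum at a non-split place. -/
  towerDatum : NonsplitPlace → TowerDatum
  /-- `β′_v`, a character of `H(V₀) = U(V′_v)`, at a non-split place. -/
  β' : ∀ v, (towerDatum v).H 0 →* ℂˣ
  /-- GQT's zeta data at a split place, for the pair `(G_n, G_m) = (U(W₁₂,v), U(V_v))`. -/
  zetaSplit : ∀ v, ZetaDatum (splitDatum v).pair
  /-- GQT's zeta data at a non-split place, for the pair `(G(W), H(V₁))`, `V₁ ≅ V_v`. -/
  zetaNonsplit : ∀ v, ZetaDatum ((towerDatum v).pair 1)

namespace FinitePlacesDatum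

variable (D : FinitePlacesDatum)

/-- Interface Prop: `π₀,v` is irreducible and smooth at every finite place. -/
def IrreducibleSmooth : Prop :=
  (∀ v, (D.splitDatum v).Irreducible ∧ (D.splitDatum v).Smooth) ∧
    ∀ v, (D.towerDatum v).Irreducible ∧ (D.towerDatum v).Smooth

/-- Interface Prop: `n ≤ m` at the split places (`n = 2 ≤ m = 3` for `(GL₂, GL₃)`). -/
def TypeIISizes : Prop :=
  ∀ v, (D.splitDatum v).n ≤ (D.splitDatum v).m

/-- Interface Prop, TIER5 §B's standing datum «π₀,v = θ_{W₁₂,v}(β′_v)» at the non-split places: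
`Hom_{G(W)×H(V₀)}(ω_{V₀}, π₀,v ⊠ β′_v) ≠ 0`. -/
def FirstLift : Prop :=
  ∀ v, HasPartner ((D.towerDatum v).ω 0) (D.towerDatum v).π (charLinRep (D.β' v))

/-- (R2) in its representation-theoretic form: the local theta lift of `π₀,v` to `U(V_v)` is
non-zero at every finite place — `Hom_{G_n}(ω_{n,m}, π₀,v) ≠ 0` at the split places and
`Θ_{V₁,W,χ,ψ}(π₀,v) ≠ 0` at the non-split places. -/
def ThetaNonzeroEverywhere : Prop :=
  (∀ v, (D.splitDatum v).HomNonzero) ∧ ∀ v, (D.towerDatum v).Occurs 1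

/-- (R2) in its zeta-integral form (TIER5 §B row B0, the form Proposition N* side B consumes):
`Z_v^*(½) ≢ 0` on `R(V_v) ⊗ π₀,v^∨ ⊗ π₀,v` at every finite place. -/
def ZetaNonzeroEverywhere : Prop :=
  (∀ v, (D.zetaSplit v).Nonzero) ∧ ∀ v, (D.zetaNonsplit v).Nonzero

end FinitePlacesDatum

end Summit.Ventures.HodgeRepro2.T6.N42Datum
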